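import Literature.NumberTheory.Automorphic.Liu2021.AppendixC.HeckeTranslates
import Mathlib.Topology.Algebra.OpenSubgroup
import Mathlib.GroupTheory.Index
import HarnessLib

/-!
# Traces of levels: `A ∩ B` is a normal subgroup of finite index of a level `B` normalising the level `A`; the `K ∩ tKt⁻¹` bookkeeping

Topic `NumberTheory/Automorphic/Liu2021/AppendixC`; namespace `Literature.NumberTheory.Automorphic.Liu2021.AppendixC` (`C5.SmallLevel`,
`C5`).  PROOF FILE (theorems only; no definition, no named fact, no instance, no `sorry`); sequel of ★ `AppendixC/HeckeTranslates.lean`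
(`C5.SmallLevel`, `C5.HeckeLE`, `C5.heckeLevel`).

For sufficiently small levels `A, B ≤ K₀` of a topological group `H` (open compact subgroups, [Liu2021] Prop. C.5 ∕ §4.2;
[Milne2005ShimuraVarieties] §5):
* `C5.SmallLevel.normal_subgroupOf_of_heckeLE` — if `k⁻¹ A k ⊆ A` for `k ∈ B` (`HeckeLE k A A`), the trace `A.subgroupOf B` is a NORMAL
  subgroup of `B` («`K′` normal in `K`», the hypothesis under which `Sh_K = Sh_{K′}/(K/K′)`, [Milne2005ShimuraVarieties] Rem. 5.29 (c));
* `C5.SmallLevel.finiteIndex_subgroupOf` — the trace has FINITE INDEX in `B` (`A` open, `B` compact: the finite group `K/K′`);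
* `C5.conj_mem_inf_map_conj`, `C5.inv_mul_inv_mem_of_conj` — the two membership facts about `K₁ = K ∩ tKt⁻¹` behind the reindexing of a
  double coset `K t K / K` by `K / K₁` ([Milne2005ShimuraVarieties] §13 p. 118: the Hecke correspondence through `K ∩ gKg⁻¹`): if
  `k, (kt)⁻¹r ∈ K`, `r⁻¹Nr ⊆ K`, `N ⊆ K` then `k⁻¹Nk ⊆ K₁`; if `k, g ∈ K` and `(kt)⁻¹(g⁻¹t) ∈ K` then `k⁻¹g⁻¹ ∈ K₁`.

Use (cell `hodgecm-mathlib`, FLOOR 0, P5a, crux `HLiu418` = stmt-HodgeConjecture-24832, line `F0_D9opRoad2`): the finite-index ∕ normality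
inputs of ★ `Motives/SepQuotientIntermediateFibres` §4 for the level actions of a Shimura tower (`↥K →* Aut M_N`, `N` acting trivially),
and the coset bookkeeping of the (Γ3-Q) reindexing `KtK/K ↠ u′-fibre`.  Generic: no Shimura datum, no model, no place.
HC_CM is proved only modulo the 7 printed citations until rung 0 of the ladder closes; this file is unconditional.

## References
* [Milne2005ShimuraVarieties] J. S. Milne, *Introduction to Shimura varieties* (2005), §5 p. 57 L7–12, Rem. 5.29 (c) p. 65; §13 p. 118 L21–26.
* [Liu2021] Y. Liu, Camb. J. Math. 9 (2021) = arXiv:2102.11518, §4.2 (l. 2060–2074), App. C Prop. C.5.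
-/

set_option autoImplicit false

namespace Literature.NumberTheory.Automorphic.Liu2021.AppendixC

variable {H : Type} [Group H]

/-! ## §1 Traces of levels -/

namespace C5.SmallLevel

variable [TopologicalSpace H] {K₀ : OpenCompactSubgroup H}

/-- **The trace `A ∩ B` is normal in `B` when `B` normalises `A`**: for levels `A`, `B` with `k⁻¹ A k ⊆ A` for all `k ∈ B`
(`HeckeLE k A A`), `A.subgroupOf B` is a normal subgroup of `B`.  [cite: Milne2005ShimuraVarieties, §5 p. 57 L7–12 and Rem. 5.29 (c) p. 65] -/
theorem normal_subgroupOf_of_heckeLE (A B : SmallLevel K₀) (hn : ∀ k ∈ B.1.1, HeckeLE k A A) :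
    ((A.1.1 : Subgroup H).subgroupOf B.1.1).Normal := by
  refine ⟨fun n hn' g => ?_⟩
  rw [Subgroup.mem_subgroupOf] at hn' ⊢
  have h1 := hn (g⁻¹ : ↥(B.1.1 : Subgroup H)) (g⁻¹).2 _ hn'
  simpa only [Subgroup.coe_inv, inv_inv, Subgroup.coe_mul] using h1

/-- **The trace `A ∩ B` has finite index in `B`**: `A` is open and `B` compact, so `B/(A ∩ B)` is finite (the finite group `K/K′` of
[Milne2005ShimuraVarieties] Rem. 5.29 (c)).  [cite: Milne2005ShimuraVarieties, §5 p. 57 L7–12 and Rem. 5.29 (c) p. 65] -/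
theorem finiteIndex_subgroupOf [IsTopologicalGroup H] (A B : SmallLevel K₀) : ((A.1.1 : Subgroup H).subgroupOf B.1.1).FiniteIndex := by
  haveI : CompactSpace ↥(B.1.1 : Subgroup H) := isCompact_iff_compactSpace.1 B.1.2.2
  have hNo : IsOpen (((A.1.1 : Subgroup H).subgroupOf B.1.1 : Subgroup ↥(B.1.1 : Subgroup H)) : Set ↥(B.1.1 : Subgroup H)) :=
    A.1.2.1.preimage continuous_subtype_val
  haveI := Subgroup.quotient_finite_of_isOpen _ hNo
  exact Subgroup.finiteIndex_of_finite_quotient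

end C5.SmallLevel

/-! ## §2 The `K₁ = K ∩ tKt⁻¹` bookkeeping -/

namespace C5

/-- **Double-coset bookkeeping, I**: if `k ∈ K`, `(k t)⁻¹ r ∈ K` (i.e. `r ∈ k t K`), `r⁻¹ N r ⊆ K`, `N ⊆ K` and `K₁ = K ∩ tKt⁻¹`, then
`k⁻¹ N k ⊆ K₁` — the source level `N` of the translate `T_r : M_N → M_K` is an admissible source for `T_k : M_N → M_{K₁}`.
[cite: Milne2005ShimuraVarieties, §13 p. 118 L21–26] -/
theorem conj_mem_inf_map_conj {K K₁ N : Subgroup H} {t k r : H} (hK₁ : K₁ = K ⊓ K.map (MulAut.conj t).toMonoidHom)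
    (hNK : N ≤ K) (hk : k ∈ K) (hk' : (k * t)⁻¹ * r ∈ K) (hr : ∀ n ∈ N, r⁻¹ * n * r ∈ K) :
    ∀ n ∈ N, k⁻¹ * n * k ∈ K₁ := by
  intro n hn
  rw [hK₁, Subgroup.mem_inf]
  refine ⟨K.mul_mem (K.mul_mem (K.inv_mem hk) (hNK hn)) hk, ?_⟩
  rw [Subgroup.mem_map]
  refine ⟨t⁻¹ * (k⁻¹ * n * k) * t, ?_, ?_⟩
  · have h2 : t⁻¹ * (k⁻¹ * n * k) * t = ((k * t)⁻¹ * r) * (r⁻¹ * n * r) * ((k * t)⁻¹ * r)⁻¹ := by group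
    rw [h2]
    exact K.mul_mem (K.mul_mem hk' (hr n hn)) (K.inv_mem hk')
  · rw [MulEquiv.coe_toMonoidHom, MulAut.conj_apply]
    group

/-- **Double-coset bookkeeping, II**: if `k, g ∈ K`, `(k t)⁻¹ (g⁻¹ t) ∈ K` (i.e. `k t K = g⁻¹ t K`) and `K₁ = K ∩ tKt⁻¹`, then
`k⁻¹ g⁻¹ ∈ K₁` — the cosets `k t K`, `k ∈ K`, of `K t K / K` are indexed by `K / K₁`.  [cite: Milne2005ShimuraVarieties, §13 p. 118 L21–26] -/
theorem inv_mul_inv_mem_of_conj {K K₁ : Subgroup H} {t k g : H} (hK₁ : K₁ = K ⊓ K.map (MulAut.conj t).toMonoidHom)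
    (hk : k ∈ K) (hg : g ∈ K) (hκ : (k * t)⁻¹ * (g⁻¹ * t) ∈ K) : k⁻¹ * g⁻¹ ∈ K₁ := by
  rw [hK₁, Subgroup.mem_inf]
  refine ⟨K.mul_mem (K.inv_mem hk) (K.inv_mem hg), ?_⟩
  rw [Subgroup.mem_map]
  refine ⟨(k * t)⁻¹ * (g⁻¹ * t), hκ, ?_⟩
  rw [MulEquiv.coe_toMonoidHom, MulAut.conj_apply]
  group

end C5

end Literature.NumberTheory.Automorphic.Liu2021.AppendixC
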